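import Mathlib.Algebra.Order.Chebyshev
import Summits.AtomisticToContinuum.Crystallization.Theorems.ExcessDecayLiouvilleHcpLiouvilleBlowdownLinCaccioppoli

/-!
# `ExcessDecayLiouville.HcpLiouville` (stmt-AtomisticToContinuum-9332), line `Sketch` (skeleton v4): one Caccioppoli level with forcing

Helper for stub `stub_interior` (step (4) of the interior estimate for `L`-harmonic fields): the landed linear
Caccioppoli inequality `blowdown_linCaccioppoli` (D1) charges the equation only through the TRUNCATED rows
`Φ_p = Σ_{q ∈ S ∩ B_{ρK}} K(p − q)(F p − F q)`.  For a field `F` vanishing on the sites outside `B_{R₀}(c)` whose FULL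
rows on `B_{ρ₁+δ}(c)` are a forcing `g` with `‖g‖² ≤ Γ` there, the truncated row is the forcing minus two tails
(`Blowdown.norm_truncRow_le`: `‖Φ_p‖ ≤ ‖g p‖ + (K₀/δ⁵)‖F p‖ + 248064 δ⁻⁸ Σ_{q ∈ B_{R₀}} ‖F q‖`), and Cauchy–Schwarz
with the packing count `≤ 32 r³` gives the LEVEL ESTIMATE `blowdown_levelStep` (registered):
`nnEnergy S F c (ρ₁ − 2) ≤ (C/κ)·(δ⁻² M′ + δ² ρK³ Γ + δ⁻⁸ (μ R₀³ M + μ⁻¹ ρK³ M′))` for every `μ > 0`, where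
`M′ = oscAt S F c ρK 0` and `M = oscAt S F c R₀ 0` (the free parameter `μ` balances the two masses at each
difference level of the assembly).
All `[folklore]`; a `--supports` helper for item stmt-AtomisticToContinuum-9332, nothing here closes an item.
-/

noncomputable section

namespace Summit.AtomisticToContinuum.Crystallization.Theorems.ExcessDecayLiouville

open scoped BigOperators Topology Classical InnerProductSpace RealInnerProductSpace
open Literature.MathematicalPhysics.StatisticalMechanics
open Summit.AtomisticToContinuum.Crystallization.Theses.ExcessDecayLiouville
open Summit.AtomisticToContinuum.Crystallization.Theorems.PhononStabilityNegative

namespace Blowdown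

open LevelOne

variable {t : Fin 2 → (EuclideanSpace ℝ (Fin 3))}
  {A : (EuclideanSpace ℝ (Fin 3)) →L[ℝ] (EuclideanSpace ℝ (Fin 3))}

/-! ## The truncated row is the forcing minus two tails -/

/-- **The truncated row is the forcing minus two tails**: for a field `F` vanishing on the sites outside `B_{R₀}(c)`
whose full row at the site `p ∈ B_{ρ₁+δ}(c)` has sum `gp`, and `ρ₁ + 2δ ≤ ρK`, `1 ≤ δ`,
`‖Σ_{q ∈ S∩B_{ρK}} K(p−q)(F p − F q)‖ ≤ ‖gp‖ + (K₀/δ⁵)‖F p‖ + 248064 δ⁻⁸ Σ_{q ∈ S∩B_{R₀}} ‖F q‖`. [folklore] -/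
theorem norm_truncRow_le (hA : Adm₀ A) (hI : Inner₀ t A)
    {F : EuclideanSpace ℝ (Fin 3) → EuclideanSpace ℝ (Fin 3)} {c : EuclideanSpace ℝ (Fin 3)} {ρ₁ δ ρK R₀ : ℝ}
    (hδ : 1 ≤ δ) (hK : ρ₁ + 2 * δ ≤ ρK)
    (hsupp : ∀ q : Sites₀ t A, R₀ < dist (q : EuclideanSpace ℝ (Fin 3)) c → F q = 0)
    (p : Sites₀ t A) (hpc : dist (p : EuclideanSpace ℝ (Fin 3)) c ≤ ρ₁ + δ) {gp : EuclideanSpace ℝ (Fin 3)}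
    (hrow : HasSum (fun q : Sites₀ t A => forceConst ((p : EuclideanSpace ℝ (Fin 3)) - q) (F p - F q)) gp) :
    ‖∑ q ∈ (finite_sites_ball hA hI c ρK).toFinset, forceConst ((p : EuclideanSpace ℝ (Fin 3)) - q) (F p - F q)‖ ≤
      ‖gp‖ + K₀ / δ ^ 5 * ‖F p‖ +
        248064 * (δ⁻¹) ^ 8 * ∑ q ∈ (finite_sites_ball hA hI c R₀).toFinset, ‖F q‖ := by
  set PK := (finite_sites_ball hA hI c ρK).toFinset with hPK
  set P₀ := (finite_sites_ball hA hI c R₀).toFinset with hP₀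
  have hmemK : ∀ q : Sites₀ t A, q ∈ PK ↔ dist (q : EuclideanSpace ℝ (Fin 3)) c ≤ ρK := fun q => by
    rw [hPK, Set.Finite.mem_toFinset]; rfl
  have hmem0 : ∀ q : Sites₀ t A, q ∈ P₀ ↔ dist (q : EuclideanSpace ℝ (Fin 3)) c ≤ R₀ := fun q => by
    rw [hP₀, Set.Finite.mem_toFinset]; rfl
  have hδ0 : 0 < δ := by linarith
  -- the three-piece split of the row
  have hsplit : ∀ q : Sites₀ t A, forceConst ((p : EuclideanSpace ℝ (Fin 3)) - q) (F p - F q) =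
      (if q ∈ PK then forceConst ((p : EuclideanSpace ℝ (Fin 3)) - q) (F p - F q) else 0) +
        (if ρK < dist (q : EuclideanSpace ℝ (Fin 3)) c then
          forceConst ((p : EuclideanSpace ℝ (Fin 3)) - q) (F p) else 0) -
        (if ρK < dist (q : EuclideanSpace ℝ (Fin 3)) c then
          forceConst ((p : EuclideanSpace ℝ (Fin 3)) - q) (F q) else 0) := by
    intro q
    by_cases hq : dist (q : EuclideanSpace ℝ (Fin 3)) c ≤ ρK
    · rw [if_pos ((hmemK q).2 hq), if_neg (not_lt.2 hq), if_neg (not_lt.2 hq), add_zero, sub_zero]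
    · rw [if_neg (fun h => hq ((hmemK q).1 h)), if_pos (not_le.1 hq), if_pos (not_le.1 hq), zero_add, ← map_sub]
  have s1 : Summable fun q : Sites₀ t A =>
      if q ∈ PK then forceConst ((p : EuclideanSpace ℝ (Fin 3)) - q) (F p - F q) else 0 :=
    summable_of_ne_finset_zero (s := PK) fun q hq => if_neg hq
  have s2 := summable_far_row hA hI c ρK p (F p)
  have s3 : Summable fun q : Sites₀ t A =>
      if ρK < dist (q : EuclideanSpace ℝ (Fin 3)) c then
        forceConst ((p : EuclideanSpace ℝ (Fin 3)) - q) (F q) else 0 := by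
    refine summable_of_ne_finset_zero (s := P₀) fun q hq => ?_
    have hfar : R₀ < dist (q : EuclideanSpace ℝ (Fin 3)) c := not_le.1 fun h => hq ((hmem0 q).2 h)
    rw [hsupp q hfar, map_zero, ite_self]
  have h1 : ∑' q : Sites₀ t A, (if q ∈ PK then forceConst ((p : EuclideanSpace ℝ (Fin 3)) - q) (F p - F q) else 0) =
      ∑ q ∈ PK, forceConst ((p : EuclideanSpace ℝ (Fin 3)) - q) (F p - F q) := by
    rw [tsum_eq_sum (s := PK) (fun q hq => if_neg hq)]
    exact Finset.sum_congr rfl fun q hq => if_pos hq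
  have htot : gp = ∑ q ∈ PK, forceConst ((p : EuclideanSpace ℝ (Fin 3)) - q) (F p - F q) +
      (∑' q : Sites₀ t A, (if ρK < dist (q : EuclideanSpace ℝ (Fin 3)) c then
          forceConst ((p : EuclideanSpace ℝ (Fin 3)) - q) (F p) else 0)) -
      ∑' q : Sites₀ t A, (if ρK < dist (q : EuclideanSpace ℝ (Fin 3)) c then
          forceConst ((p : EuclideanSpace ℝ (Fin 3)) - q) (F q) else 0) := by
    rw [← hrow.tsum_eq, tsum_congr hsplit, (s1.add s2).tsum_sub s3, s1.tsum_add s2, h1]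
  have heq : ∑ q ∈ PK, forceConst ((p : EuclideanSpace ℝ (Fin 3)) - q) (F p - F q) =
      gp - (∑' q : Sites₀ t A, (if ρK < dist (q : EuclideanSpace ℝ (Fin 3)) c then
          forceConst ((p : EuclideanSpace ℝ (Fin 3)) - q) (F p) else 0)) +
      ∑' q : Sites₀ t A, (if ρK < dist (q : EuclideanSpace ℝ (Fin 3)) c then
          forceConst ((p : EuclideanSpace ℝ (Fin 3)) - q) (F q) else 0) := by
    rw [htot]; abel
  -- the two tails
  have hT1 := norm_tsum_far_row_le hA hI hδ hK p hpc (F p)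
  have hT2 : ‖∑' q : Sites₀ t A, (if ρK < dist (q : EuclideanSpace ℝ (Fin 3)) c then
      forceConst ((p : EuclideanSpace ℝ (Fin 3)) - q) (F q) else 0)‖ ≤
      248064 * (δ⁻¹) ^ 8 * ∑ q ∈ P₀, ‖F q‖ := by
    rw [tsum_eq_sum (s := P₀) (fun q hq => by
      have hfar : R₀ < dist (q : EuclideanSpace ℝ (Fin 3)) c := not_le.1 fun h => hq ((hmem0 q).2 h)
      rw [hsupp q hfar, map_zero, ite_self]), Finset.mul_sum]
    refine (norm_sum_le _ _).trans (Finset.sum_le_sum fun q _ => ?_)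
    split_ifs with hq
    · have hdq : δ ≤ dist (p : EuclideanSpace ℝ (Fin 3)) q := by
        have := dist_triangle (q : EuclideanSpace ℝ (Fin 3)) p c
        rw [dist_comm (q : EuclideanSpace ℝ (Fin 3)) p] at this
        linarith
      have hne : (p : EuclideanSpace ℝ (Fin 3)) ≠ q := by
        intro h; rw [h, dist_self] at hdq; linarith
      refine (norm_forceConst_apply_le_ker hA hI p.2 q.2 (F q)).trans ?_
      rw [ker_of_ne hne]
      have hd0 : 0 < dist (p : EuclideanSpace ℝ (Fin 3)) q := by linarith
      have hi : (dist (p : EuclideanSpace ℝ (Fin 3)) q)⁻¹ ≤ δ⁻¹ := inv_anti₀ hδ0 hdq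
      have hi0 : 0 ≤ (dist (p : EuclideanSpace ℝ (Fin 3)) q)⁻¹ := by positivity
      have h8 := pow_le_pow_left₀ hi0 hi 8
      have hF0 := norm_nonneg (F q)
      nlinarith
    · rw [norm_zero]; positivity
  rw [heq]
  calc _ ≤ ‖gp - ∑' q : Sites₀ t A, (if ρK < dist (q : EuclideanSpace ℝ (Fin 3)) c then
          forceConst ((p : EuclideanSpace ℝ (Fin 3)) - q) (F p) else 0)‖ +
        ‖∑' q : Sites₀ t A, (if ρK < dist (q : EuclideanSpace ℝ (Fin 3)) c then
          forceConst ((p : EuclideanSpace ℝ (Fin 3)) - q) (F q) else 0)‖ := norm_add_le _ _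
    _ ≤ (‖gp‖ + K₀ / δ ^ 5 * ‖F p‖) + 248064 * (δ⁻¹) ^ 8 * ∑ q ∈ P₀, ‖F q‖ :=
        add_le_add ((norm_sub_le _ _).trans (add_le_add le_rfl hT1)) hT2

/-! ## Elementary inequalities -/

/-- `x y ≤ x²/(2α) + α y²/2` for `α > 0`. [folklore] -/
theorem mul_le_sq_div_add {x y α : ℝ} (hα : 0 < α) : x * y ≤ x ^ 2 / (2 * α) + α * y ^ 2 / 2 := by
  have h : 0 ≤ (x - α * y) ^ 2 := sq_nonneg _
  rw [div_add_div _ _ (by positivity) two_ne_zero, le_div_iff₀ (by positivity)]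
  nlinarith

/-- The `ℓ¹` mass of a field on the sites of a ball: `(Σ_{B_r} ‖F‖)² ≤ 32 r³ Σ_{B_r} ‖F‖²` (`r ≥ 1`). [folklore] -/
theorem sq_sum_norm_le (hA : Adm₀ A) (hI : Inner₀ t A) (F : EuclideanSpace ℝ (Fin 3) → EuclideanSpace ℝ (Fin 3))
    (c : EuclideanSpace ℝ (Fin 3)) {r : ℝ} (hr : 1 ≤ r) :
    (∑ q ∈ (finite_sites_ball hA hI c r).toFinset, ‖F q‖) ^ 2 ≤
      32 * r ^ 3 * ∑ q ∈ (finite_sites_ball hA hI c r).toFinset, ‖F q‖ ^ 2 := by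
  have h1 := sq_sum_le_card_mul_sum_sq (s := (finite_sites_ball hA hI c r).toFinset) (f := fun q => ‖F q‖)
  have hcard := card_sites_le hA hI c hr (finite_sites_ball hA hI c r).toFinset
    (fun q hq => by rw [Set.Finite.mem_toFinset] at hq; exact hq)
  exact h1.trans (mul_le_mul_of_nonneg_right hcard (Finset.sum_nonneg fun _ _ => sq_nonneg _))

/-- `oscAt S F c r 0` is the finite sum `Σ_{S ∩ B_r} ‖F‖²`. [folklore] -/
theorem oscAt_zero_eq_sum (hA : Adm₀ A) (hI : Inner₀ t A) (F : EuclideanSpace ℝ (Fin 3) → EuclideanSpace ℝ (Fin 3))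
    (c : EuclideanSpace ℝ (Fin 3)) (r : ℝ) :
    oscAt (Sites₀ t A) F c r 0 = ∑ q ∈ (finite_sites_ball hA hI c r).toFinset, ‖F q‖ ^ 2 := by
  rw [oscAt, tsum_ball_eq_sum hA hI c r (fun x => ‖F x - 0‖ ^ 2)]
  simp only [sub_zero]

end Blowdown

open LevelOne in
/-- **One Caccioppoli level with forcing** (registered sub-goal `blowdown_levelStep`, step (4) of stub
`stub_interior`, crux stmt-AtomisticToContinuum-9332, line `Sketch` v4): on the sites `S` of an admissible hcp-like
datum satisfying `PSIneq κ`, for a field `F` vanishing on the sites outside `B_{R₀}(c)` whose full rows on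
`B_{ρ₁+δ}(c)` have sums `g p` with `‖g p‖² ≤ Γ`, and radii `4 ≤ ρ₁`, `1 ≤ δ ≤ ρ₁`, `ρ₁ + 2δ ≤ ρK ≤ R₀`, for every
`μ > 0`: `nnEnergy S F c (ρ₁ − 2) ≤ (C/κ)(δ⁻² M′ + δ² ρK³ Γ + δ⁻⁸(μ R₀³ M + μ⁻¹ ρK³ M′))`,
`M′ = oscAt S F c ρK 0`, `M = oscAt S F c R₀ 0`. [folklore] -/
theorem blowdown_levelStep : ∃ C : ℝ, 0 ≤ C ∧ ∀ (κ : ℝ) (t : Fin 2 → (EuclideanSpace ℝ (Fin 3)))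
    (A : (EuclideanSpace ℝ (Fin 3)) →L[ℝ] (EuclideanSpace ℝ (Fin 3))), 0 < κ → Adm₀ A → Inner₀ t A →
    Blowdown.PSIneq κ t A →
    ∀ (F g : (EuclideanSpace ℝ (Fin 3)) → (EuclideanSpace ℝ (Fin 3))) (c : (EuclideanSpace ℝ (Fin 3)))
      (ρ₁ δ ρK R₀ Γ μ : ℝ), 4 ≤ ρ₁ → 1 ≤ δ → δ ≤ ρ₁ → ρ₁ + 2 * δ ≤ ρK → ρK ≤ R₀ → 0 ≤ Γ → 0 < μ →
      (∀ q : Sites₀ t A, R₀ < dist (q : (EuclideanSpace ℝ (Fin 3))) c → F q = 0) →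
      (∀ p : Sites₀ t A, dist (p : (EuclideanSpace ℝ (Fin 3))) c ≤ ρ₁ + δ →
        HasSum (fun q : Sites₀ t A => forceConst ((p : (EuclideanSpace ℝ (Fin 3))) - q) (F p - F q)) (g p)) →
      (∀ p : Sites₀ t A, dist (p : (EuclideanSpace ℝ (Fin 3))) c ≤ ρ₁ + δ → ‖g p‖ ^ 2 ≤ Γ) →
      Blowdown.nnEnergy (Sites₀ t A) F c (ρ₁ - 2) ≤
        C / κ * ((δ⁻¹) ^ 2 * Blowdown.oscAt (Sites₀ t A) F c ρK 0 + δ ^ 2 * ρK ^ 3 * Γ +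
          (δ⁻¹) ^ 8 * (μ * R₀ ^ 3 * Blowdown.oscAt (Sites₀ t A) F c R₀ 0 +
            μ⁻¹ * ρK ^ 3 * Blowdown.oscAt (Sites₀ t A) F c ρK 0)) := by
  obtain ⟨C₁, hC₁⟩ := blowdown_linCaccioppoli
  have hK₀ := K₀_pos
  refine ⟨max C₁ 0 * (3969026 + K₀), by positivity, ?_⟩
  intro κ t A hκ hA hI hPS F g c ρ₁ δ ρK R₀ Γ μ hρ₁ hδ hδρ hK hR₀ hΓ hμ hsupp hrows hg
  have hD := hC₁ κ t A hκ hA hI hPS F c 0 ρ₁ δ ρK hρ₁ hδ hδρ hK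
  set P₁ := (finite_sites_ball hA hI c (ρ₁ + δ)).toFinset with hP₁
  set PK := (finite_sites_ball hA hI c ρK).toFinset with hPK
  set P₀ := (finite_sites_ball hA hI c R₀).toFinset with hP₀
  have hmem1 : ∀ q : Sites₀ t A, q ∈ P₁ ↔ dist (q : EuclideanSpace ℝ (Fin 3)) c ≤ ρ₁ + δ := fun q => by
    rw [hP₁, Set.Finite.mem_toFinset]; rfl
  have hmemK : ∀ q : Sites₀ t A, q ∈ PK ↔ dist (q : EuclideanSpace ℝ (Fin 3)) c ≤ ρK := fun q => by
    rw [hPK, Set.Finite.mem_toFinset]; rfl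
  have hδ0 : 0 < δ := by linarith
  have hρK1 : 1 ≤ ρK := by linarith
  have hR₀1 : 1 ≤ R₀ := by linarith
  set M' := Blowdown.oscAt (Sites₀ t A) F c ρK 0 with hM'
  set M := Blowdown.oscAt (Sites₀ t A) F c R₀ 0 with hM
  set N₁ := ∑ q ∈ P₀, ‖F q‖ with hN₁
  set N₁' := ∑ q ∈ P₁, ‖F q‖ with hN₁'
  set M₁ := ∑ q ∈ P₁, ‖F q‖ ^ 2 with hM₁
  have hM'eq : M' = ∑ q ∈ PK, ‖F q‖ ^ 2 := Blowdown.oscAt_zero_eq_sum hA hI F c ρK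
  have hMeq : M = ∑ q ∈ P₀, ‖F q‖ ^ 2 := Blowdown.oscAt_zero_eq_sum hA hI F c R₀
  have hM'0 : 0 ≤ M' := Blowdown.oscAt_nonneg _ _ _ _ _
  have hM0 : 0 ≤ M := Blowdown.oscAt_nonneg _ _ _ _ _
  have hN₁0 : 0 ≤ N₁ := Finset.sum_nonneg fun _ _ => norm_nonneg _
  have hN₁'0 : 0 ≤ N₁' := Finset.sum_nonneg fun _ _ => norm_nonneg _
  have hM₁M' : M₁ ≤ M' := by
    rw [hM'eq]
    refine Finset.sum_le_sum_of_subset_of_nonneg (fun q hq => ?_) fun _ _ _ => sq_nonneg _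
    rw [hmemK]; exact ((hmem1 q).1 hq).trans (by linarith)
  -- Cauchy–Schwarz with the packing count
  have hCS1 : N₁' ^ 2 ≤ 32 * ρK ^ 3 * M' := by
    have h := Blowdown.sq_sum_norm_le hA hI F c (show 1 ≤ ρ₁ + δ by linarith)
    refine h.trans ?_
    have : (ρ₁ + δ) ^ 3 ≤ ρK ^ 3 := pow_le_pow_left₀ (by linarith) (by linarith) 3
    exact mul_le_mul (mul_le_mul_of_nonneg_left this (by norm_num)) hM₁M'
      (Finset.sum_nonneg fun _ _ => sq_nonneg _) (by positivity)
  have hCS0 : N₁ ^ 2 ≤ 32 * R₀ ^ 3 * M := by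
    rw [hMeq]; exact Blowdown.sq_sum_norm_le hA hI F c hR₀1
  -- the work term as a finite sum, bounded pointwise
  have hW : (∑' p : {s : EuclideanSpace ℝ (Fin 3) // s ∈ Sites₀ t A ∧ dist s c ≤ ρ₁ + δ}, ‖F p - 0‖ *
      ‖∑' q : {s : EuclideanSpace ℝ (Fin 3) // s ∈ Sites₀ t A ∧ dist s c ≤ ρK},
        forceConst ((p : EuclideanSpace ℝ (Fin 3)) - q) (F p - F q)‖) ≤
      N₁' * Real.sqrt Γ + K₀ / δ ^ 5 * M₁ + 248064 * (δ⁻¹) ^ 8 * N₁ * N₁' := by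
    rw [Blowdown.tsum_ball_eq_sum hA hI c (ρ₁ + δ) (fun x => ‖F x - 0‖ *
      ‖∑' q : {s : EuclideanSpace ℝ (Fin 3) // s ∈ Sites₀ t A ∧ dist s c ≤ ρK}, forceConst (x - q) (F x - F q)‖)]
    have hpt : ∀ p ∈ P₁, ‖F p - 0‖ *
        ‖∑' q : {s : EuclideanSpace ℝ (Fin 3) // s ∈ Sites₀ t A ∧ dist s c ≤ ρK},
          forceConst ((p : EuclideanSpace ℝ (Fin 3)) - q) (F p - F q)‖ ≤
        ‖F p‖ * Real.sqrt Γ + K₀ / δ ^ 5 * ‖F p‖ ^ 2 + 248064 * (δ⁻¹) ^ 8 * N₁ * ‖F p‖ := by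
      intro p hp
      have hpc := (hmem1 p).1 hp
      rw [sub_zero, Blowdown.tsum_ball_eq_sum hA hI c ρK (fun y => forceConst ((p : EuclideanSpace ℝ (Fin 3)) - y) (F p - F y))]
      have h1 := Blowdown.norm_truncRow_le hA hI hδ hK hsupp p hpc (hrows p hpc)
      have h2 : ‖g p‖ ≤ Real.sqrt Γ := by
        rw [← Real.sqrt_sq (norm_nonneg (g p))]
        exact Real.sqrt_le_sqrt (hg p hpc)
      have hF0 := norm_nonneg (F p)
      calc _ ≤ ‖F p‖ * (Real.sqrt Γ + K₀ / δ ^ 5 * ‖F p‖ + 248064 * (δ⁻¹) ^ 8 * N₁) :=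
            mul_le_mul_of_nonneg_left (h1.trans (by linarith)) hF0
        _ = _ := by ring
    refine (Finset.sum_le_sum hpt).trans (le_of_eq ?_)
    rw [Finset.sum_add_distrib, Finset.sum_add_distrib, hN₁', hM₁, Finset.sum_mul, ← Finset.mul_sum,
      Finset.mul_sum _ _ (248064 * (δ⁻¹) ^ 8 * N₁)]
  -- the three pieces of the work term
  have hp1 : N₁' * Real.sqrt Γ ≤ (δ⁻¹) ^ 2 * M' / 2 + 16 * δ ^ 2 * ρK ^ 3 * Γ := by
    have h := Blowdown.mul_le_sq_div_add (x := N₁') (y := Real.sqrt Γ) (α := 32 * δ ^ 2 * ρK ^ 3) (by positivity)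
    rw [Real.sq_sqrt hΓ] at h
    refine h.trans ?_
    have h3 : N₁' ^ 2 / (2 * (32 * δ ^ 2 * ρK ^ 3)) ≤ (δ⁻¹) ^ 2 * M' / 2 := by
      rw [div_le_iff₀ (by positivity)]
      calc N₁' ^ 2 ≤ 32 * ρK ^ 3 * M' := hCS1
        _ = (δ⁻¹) ^ 2 * M' / 2 * (2 * (32 * δ ^ 2 * ρK ^ 3)) := by field_simp
    have h4 : 32 * δ ^ 2 * ρK ^ 3 * Real.sqrt Γ ^ 2 / 2 = 16 * δ ^ 2 * ρK ^ 3 * Γ := by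
      rw [Real.sq_sqrt hΓ]; ring
    linarith
  have hp2 : K₀ / δ ^ 5 * M₁ ≤ K₀ * (δ⁻¹) ^ 2 * M' := by
    have h5 : K₀ / δ ^ 5 ≤ K₀ * (δ⁻¹) ^ 2 := by
      rw [inv_pow, ← div_eq_mul_inv]
      exact div_le_div_of_nonneg_left hK₀.le (by positivity) (pow_le_pow_right₀ hδ (by norm_num))
    exact mul_le_mul h5 hM₁M' (Finset.sum_nonneg fun _ _ => sq_nonneg _) (by positivity)
  have hp3 : 248064 * (δ⁻¹) ^ 8 * N₁ * N₁' ≤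
      248064 * (δ⁻¹) ^ 8 * (16 * (μ * R₀ ^ 3 * M + μ⁻¹ * ρK ^ 3 * M')) := by
    rw [mul_assoc (248064 * (δ⁻¹) ^ 8)]
    refine mul_le_mul_of_nonneg_left ?_ (by positivity)
    have h := Blowdown.mul_le_sq_div_add (x := N₁') (y := N₁) (α := μ) hμ
    rw [mul_comm] at h
    refine h.trans ?_
    have h6 : N₁' ^ 2 / (2 * μ) ≤ 16 * (μ⁻¹ * ρK ^ 3 * M') := by
      rw [div_le_iff₀ (by positivity)]
      calc N₁' ^ 2 ≤ 32 * ρK ^ 3 * M' := hCS1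
        _ = 16 * (μ⁻¹ * ρK ^ 3 * M') * (2 * μ) := by field_simp; ring
    have h7 : μ * N₁ ^ 2 / 2 ≤ 16 * (μ * R₀ ^ 3 * M) := by
      rw [div_le_iff₀ two_pos]
      nlinarith [hCS0, hμ.le]
    linarith
  -- assemble
  have hO0 : 0 ≤ (δ⁻¹) ^ 2 * M' := by positivity
  have hWtot := hW.trans (add_le_add (add_le_add hp1 hp2) hp3)
  have hmax : C₁ ≤ max C₁ 0 := le_max_left _ _
  have hmax0 : 0 ≤ max C₁ 0 := le_max_right _ _
  have hinner0 : 0 ≤ (δ⁻¹) ^ 2 * M' + ∑' p : {s : EuclideanSpace ℝ (Fin 3) // s ∈ Sites₀ t A ∧ dist s c ≤ ρ₁ + δ},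
      ‖F p - 0‖ * ‖∑' q : {s : EuclideanSpace ℝ (Fin 3) // s ∈ Sites₀ t A ∧ dist s c ≤ ρK},
        forceConst ((p : EuclideanSpace ℝ (Fin 3)) - q) (F p - F q)‖ :=
    add_nonneg hO0 (tsum_nonneg fun _ => mul_nonneg (norm_nonneg _) (norm_nonneg _))
  have hX0 : 0 ≤ (δ⁻¹) ^ 2 * M' + δ ^ 2 * ρK ^ 3 * Γ + (δ⁻¹) ^ 8 * (μ * R₀ ^ 3 * M + μ⁻¹ * ρK ^ 3 * M') := by
    positivity
  calc Blowdown.nnEnergy (Sites₀ t A) F c (ρ₁ - 2)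
      ≤ C₁ / κ * ((δ⁻¹) ^ 2 * M' + ∑' p : {s : EuclideanSpace ℝ (Fin 3) // s ∈ Sites₀ t A ∧ dist s c ≤ ρ₁ + δ},
          ‖F p - 0‖ * ‖∑' q : {s : EuclideanSpace ℝ (Fin 3) // s ∈ Sites₀ t A ∧ dist s c ≤ ρK},
            forceConst ((p : EuclideanSpace ℝ (Fin 3)) - q) (F p - F q)‖) := hD
    _ ≤ max C₁ 0 / κ * ((δ⁻¹) ^ 2 * M' + ∑' p : {s : EuclideanSpace ℝ (Fin 3) // s ∈ Sites₀ t A ∧ dist s c ≤ ρ₁ + δ},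
          ‖F p - 0‖ * ‖∑' q : {s : EuclideanSpace ℝ (Fin 3) // s ∈ Sites₀ t A ∧ dist s c ≤ ρK},
            forceConst ((p : EuclideanSpace ℝ (Fin 3)) - q) (F p - F q)‖) :=
        mul_le_mul_of_nonneg_right (div_le_div_of_nonneg_right hmax hκ.le) hinner0
    _ ≤ max C₁ 0 / κ * ((δ⁻¹) ^ 2 * M' + ((δ⁻¹) ^ 2 * M' / 2 + 16 * δ ^ 2 * ρK ^ 3 * Γ + K₀ * (δ⁻¹) ^ 2 * M' +
          248064 * (δ⁻¹) ^ 8 * (16 * (μ * R₀ ^ 3 * M + μ⁻¹ * ρK ^ 3 * M')))) := by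
        gcongr
    _ ≤ max C₁ 0 / κ * ((3969026 + K₀) *
          ((δ⁻¹) ^ 2 * M' + δ ^ 2 * ρK ^ 3 * Γ + (δ⁻¹) ^ 8 * (μ * R₀ ^ 3 * M + μ⁻¹ * ρK ^ 3 * M'))) := by
        refine mul_le_mul_of_nonneg_left ?_ (by positivity)
        have hA' : 0 ≤ δ ^ 2 * ρK ^ 3 * Γ := by positivity
        have hB' : 0 ≤ (δ⁻¹) ^ 8 * (μ * R₀ ^ 3 * M + μ⁻¹ * ρK ^ 3 * M') := by positivity
        nlinarith
    _ = max C₁ 0 * (3969026 + K₀) / κ *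
          ((δ⁻¹) ^ 2 * M' + δ ^ 2 * ρK ^ 3 * Γ + (δ⁻¹) ^ 8 * (μ * R₀ ^ 3 * M + μ⁻¹ * ρK ^ 3 * M')) := by
        ring

end Summit.AtomisticToContinuum.Crystallization.Theorems.ExcessDecayLiouville

end
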